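import Literature.NumberTheory.Sieve.BombieriFriedlanderIwaniecTheorem7Sparse
import HarnessLib

/-!
# Bombieri–Friedlander–Iwaniec 1986, Theorem 7 (§14) — step 3: reciprocity and separation of variables

Topic `Literature/NumberTheory/Sieve`; continuation of `…Theorem7Poisson`.  BFI, p. 245: "We have
`e(−ah (ln)‾/qr) = e(a²h (qr)‾/(aln)) + O(x^{ε−1})`, so after separation of variables in `α̂` by
means of `α̂(h/qr) = q ∫ α(ξq) e(ξh/r) dξ` we transform (14.2) into
`∫_0^{3M/Q} |∑_r ∑_l ∑_h (δ_h/r) e(ξh/r) ∑_q ∑_n γ(q) α(ξq) β(n) e(a²h (qr)‾/(aln))| dξ + O(x^{1−ε})`".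
This file proves the corresponding EXACT statements for the oscillatory form `BFI.tripleOsc` of
`…Theorem7Poisson`: the reciprocity relation with its error term (tree: `BFI.reciprocity_dvd` of
`…Theorem5Reciprocity`), the separation of variables (the change of variables `t = qξ` in Mathlib's
Fourier integral), and the passage to the supremum over `ξ` of the separated sums.  Everything here
is PROVED; no named fact is introduced.

## Contents

* `BFI.rhoR a q r l n` — the residue `(−a)(qr)‾ mod ln`; `BFI.e_reciprocity_int` — for an integer
  `σ`, `e(σ h ρ/(qr)) = e(σ h ρ'/(ln)) e(σ a h/(qr ln))` (`ρ = a(ln)‾ mod qr`), and its error form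
  `BFI.norm_e_sub_e_reciprocity_int_le`.
* `BFI.twistPM`, `BFI.oscSum_eq_sum_twist` (both signs `±h` of `BFI.oscSum`); `BFI.recipTerm`,
  `BFI.recipI` (the `q, n, h`-sum after reciprocity), `BFI.errR` (the reciprocity error at `(r, l)`),
  **`BFI.abs_oscQ_sub_le`**: `|oscQ(r,l) − Re(recipI(+1) + recipI(−1))| ≤ errR(r,l)`.
* `BFI.inv_mul_fourier_bumpC_eq` — separation of variables `(qr)⁻¹ α̂(w/qr) = r⁻¹ ∫ α(qξ) e(−ξw/r) dξ`
  (the change of variables `t = qξ` in Mathlib's Fourier integral); `BFI.sepTerm`, **`BFI.sepSum`**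
  (the separated sum at `(ξ; r, l)`), `BFI.recipTerm_eq_integral`, `BFI.recipI_eq_integral_sepSum`,
  continuity / integrability / support (`BFI.sepSum_eq_zero_of`: `ξ ∈ (0, (2M+Y)/Q₀)` when `γ`
  lives on `q ≥ Q₀`).
* **`BFI.tripleOsc_le_of_sepSum_le`**: if for both signs and every `ξ ∈ (0, ξ₁)`,
  `∑_{r,(r,a)=1} ∑_{l,(l,r)=1} ‖sepSum σ (ξ; r, l)‖ ≤ Φ`, then
  `tripleOsc ≤ 2 ξ₁ Φ + ∑_{r,l} errR(r,l)`; **`BFI.sum_errR_le`**: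
  `∑_{r,l} errR ≤ 32π|a|(M+2Y)H₀²(1+log Xn)/R` (`≪ |a| x^{1+4ε₁} ℒ/M` for `H₀ ≍ x^{2ε₁}QR/M`, `Q²R ≤ x`).

## References

* E. Bombieri, J. B. Friedlander, H. Iwaniec, Acta Math. 156 (1986), 203–251: §12 p. 236
  (reciprocity); §14 p. 245. [BombieriFriedlanderIwaniecActa1986]
-/

noncomputable section

open Finset Real MeasureTheory
open scoped ArithmeticFunction.sigma ContDiff FourierTransform

namespace Literature.NumberTheory.Sieve

namespace BFI

/-! ### Reciprocity for integer multiples -/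

/-- The residue `ρ' = (−a)(qr)‾ (mod ln)` of the reciprocity relation.
[cite: BombieriFriedlanderIwaniecActa1986, §14 p. 245] -/
def rhoR (a : ℤ) (q r l n : ℕ) : ℕ :=
  ((((-a : ℤ) : ZMod (l * n)) * ((((q * r : ℕ) : ZMod (l * n))))⁻¹).val)

/-- **Reciprocity** (BFI p. 236/245, "`(ln)‾/qr ≡ −(qr)‾/ln + 1/(qr·ln) (mod 1)`"), for an integer
multiple `σh`: with `ρ = a (ln)‾ mod qr` and `ρ' = (−a)(qr)‾ mod ln`, `(ln, qr) = 1`,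
`e(σ ρ h/(qr)) = e(σ ρ' h/(ln)) · e(σ a h/(qr·ln))`. [cite: BombieriFriedlanderIwaniecActa1986, §12 p. 236] -/
theorem e_reciprocity_int {q r l n : ℕ} (hq : 0 < q) (hr : 0 < r) (hl : 0 < l) (hn : 0 < n)
    (hcop : (l * n).Coprime (q * r)) (a sg : ℤ) (h : ℕ) :
    ((𝐞 ((sg : ℝ) * ((((a : ZMod (q * r)) * (((l * n : ℕ) : ZMod (q * r)))⁻¹).val : ℕ) : ℝ) * h /
        ((q * r : ℕ) : ℝ)) : Circle) : ℂ) =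
      ((𝐞 ((sg : ℝ) * (rhoR a q r l n : ℝ) * h / ((l * n : ℕ) : ℝ)) : Circle) : ℂ) *
        ((𝐞 ((sg : ℝ) * a * h / (((q * r : ℕ) : ℝ) * ((l * n : ℕ) : ℝ))) : Circle) : ℂ) := by
  -- the divisibility `qr · ln ∣ ρ·ln − ρ'·qr − a` from the tree (with `c = q`, `d = ln`)
  obtain ⟨t, ht⟩ := reciprocity_dvd (c := q) (d := l * n) (r := r) hq (Nat.mul_pos hl hn) hr hcop a
  simp only [rhoR]
  set ρ : ℕ := ((a : ZMod (q * r)) * (((l * n : ℕ) : ZMod (q * r)))⁻¹).val with hρ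
  set ρ' : ℕ := (((-a : ℤ) : ZMod (l * n)) * (((q * r : ℕ) : ZMod (l * n)))⁻¹).val with hρ'
  have hq0 : (0 : ℝ) < q := by exact_mod_cast hq
  have hr0 : (0 : ℝ) < r := by exact_mod_cast hr
  have hl0 : (0 : ℝ) < l := by exact_mod_cast hl
  have hn0 : (0 : ℝ) < n := by exact_mod_cast hn
  have ht' : (ρ : ℝ) * ((l : ℝ) * n) - (ρ' : ℝ) * ((q : ℝ) * r) - a = ((q : ℝ) * r) * ((l : ℝ) * n) * t := by
    have := congrArg (Int.cast : ℤ → ℝ) ht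
    push_cast at this
    linarith
  have key : (sg : ℝ) * (ρ : ℝ) * h / ((q : ℝ) * r) =
      (sg : ℝ) * (ρ' : ℝ) * h / ((l : ℝ) * n) +
        (sg : ℝ) * a * h / (((q : ℝ) * r) * ((l : ℝ) * n)) + ((sg * h * t : ℤ) : ℝ) := by
    push_cast
    field_simp
    linear_combination (sg : ℝ) * (h : ℝ) * ht'
  push_cast
  rw [key, AddChar.map_add_eq_mul, AddChar.map_add_eq_mul, Circle.coe_mul, Circle.coe_mul, e_intCast,
    mul_one]

/-- The reciprocity error: `|e(σρh/(qr)) − e(σρ'h/(ln))| ≤ 2π|a|h/(qr·ln)` for `σ = ±1`. [folklore] -/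
theorem norm_e_sub_e_reciprocity_int_le {q r l n : ℕ} (hq : 0 < q) (hr : 0 < r) (hl : 0 < l) (hn : 0 < n)
    (hcop : (l * n).Coprime (q * r)) (a : ℤ) {sg : ℤ} (hsg : sg = 1 ∨ sg = -1) (h : ℕ) :
    ‖((𝐞 ((sg : ℝ) * ((((a : ZMod (q * r)) * (((l * n : ℕ) : ZMod (q * r)))⁻¹).val : ℕ) : ℝ) * h /
        ((q * r : ℕ) : ℝ)) : Circle) : ℂ) -
      ((𝐞 ((sg : ℝ) * (rhoR a q r l n : ℝ) * h / ((l * n : ℕ) : ℝ)) : Circle) : ℂ)‖ ≤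
      2 * π * (|(a : ℝ)| * h / (((q * r : ℕ) : ℝ) * ((l * n : ℕ) : ℝ))) := by
  rw [e_reciprocity_int hq hr hl hn hcop a sg h]
  set u : ℝ := (sg : ℝ) * (rhoR a q r l n : ℝ) * h / ((l * n : ℕ) : ℝ)
  set θ : ℝ := (sg : ℝ) * a * h / (((q * r : ℕ) : ℝ) * ((l * n : ℕ) : ℝ))
  have := norm_e_add_sub_e_le u θ
  rw [AddChar.map_add_eq_mul, Circle.coe_mul] at this
  refine this.trans (le_of_eq ?_)
  congr 1
  have hσ1 : |(sg : ℝ)| = 1 := by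
    rcases hsg with rfl | rfl <;> simp
  have hpos : (0 : ℝ) < ((q * r : ℕ) : ℝ) * ((l * n : ℕ) : ℝ) := by
    have h1 : (0 : ℝ) < ((q * r : ℕ) : ℝ) := by exact_mod_cast Nat.mul_pos hq hr
    have h2 : (0 : ℝ) < ((l * n : ℕ) : ℝ) := by exact_mod_cast Nat.mul_pos hl hn
    positivity
  simp only [θ]
  rw [abs_div, abs_mul, abs_mul, hσ1, one_mul, Nat.abs_cast, abs_of_pos hpos]

/-! ### The twisted Fourier coefficients for both signs -/

/-- `twistPM sg k c h = e(sg·c·h/k) α̂(sg·h/k)`: for `sg = 1` this is `twCoef k c h`, for `sg = −1` it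
is `twCoef k c (−h)`. [folklore] -/
def twistPM (M Y : ℝ) (sg : ℤ) (k : ℕ) (c : ZMod k) (h : ℕ) : ℂ :=
  ((𝐞 ((sg : ℝ) * (c.val : ℝ) * h / k) : Circle) : ℂ) * 𝓕 (bumpC M Y) ((sg : ℝ) * h / k)

/-- `twCoef k c h = twistPM 1 k c h` for `h ≥ 0`. [folklore] -/
theorem twCoef_natCast (M Y : ℝ) (k : ℕ) (c : ZMod k) (h : ℕ) :
    twCoef M Y k c (h : ℤ) = twistPM M Y 1 k c h := by
  simp only [twCoef, twistPM, fcoef, Int.cast_natCast, Int.cast_one, one_mul]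

/-- `twCoef k c (−h) = twistPM (−1) k c h`. [folklore] -/
theorem twCoef_neg_natCast (M Y : ℝ) (k : ℕ) (c : ZMod k) (h : ℕ) :
    twCoef M Y k c (-(h : ℤ)) = twistPM M Y (-1) k c h := by
  simp only [twCoef, twistPM, fcoef, Int.cast_neg, Int.cast_natCast, Int.cast_one]
  congr 2
  · congr 1; ring
  · ring

/-- `oscSum k c H₀ = ∑_{h ≤ H₀} (twistPM 1 + twistPM (−1))`. [folklore] -/
theorem oscSum_eq_sum_twist (M Y : ℝ) (k : ℕ) (c : ZMod k) (H₀ : ℕ) :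
    oscSum M Y k c H₀ = ∑ h ∈ Icc 1 H₀, (twistPM M Y 1 k c h + twistPM M Y (-1) k c h) := by
  unfold oscSum
  refine Finset.sum_congr rfl fun h _ => ?_
  rw [twCoef_natCast, twCoef_neg_natCast]

/-! ### Reciprocity applied to the oscillatory brackets -/

/-- One term of the sum after reciprocity:
`γ(q) β(n) · (qr)⁻¹ α̂(sg·h/qr) · e(sg·h ρ'/(ln))`. [cite: BombieriFriedlanderIwaniecActa1986, §14 p. 245] -/
def recipTerm (sg : ℤ) (a : ℤ) (M Y : ℝ) (β γ : ℕ → ℝ) (q r l n h : ℕ) : ℂ :=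
  ((γ q * β n : ℝ) : ℂ) *
    ((((q * r : ℕ) : ℂ))⁻¹ * 𝓕 (bumpC M Y) ((sg : ℝ) * h / ((q * r : ℕ) : ℝ))) *
      ((𝐞 ((sg : ℝ) * (rhoR a q r l n : ℝ) * h / ((l * n : ℕ) : ℝ)) : Circle) : ℂ)

/-- The `q, n, h`-sum after reciprocity at `(r, l)`, for the sign `sg`. [cite: BombieriFriedlanderIwaniecActa1986, §14 p. 245] -/
def recipI (sg : ℤ) (a : ℤ) (M Y : ℝ) (H₀ Xn Xq : ℕ) (β γ : ℕ → ℝ) (r l : ℕ) : ℂ :=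
  ∑ q ∈ (Icc 1 Xq).filter (fun q : ℕ => IsCoprime (q : ℤ) (a * l)),
    ∑ n ∈ (Icc 1 Xn).filter (fun n => n.Coprime (q * r)), ∑ h ∈ Icc 1 H₀, recipTerm sg a M Y β γ q r l n h

/-- The reciprocity error at `(r, l)`: `∑_{q ≤ Xq} ∑_{n ≤ Xn} ∑_{h ≤ H₀} 4π|a|(M + 2Y) h/((qr)² ln)`.
[cite: BombieriFriedlanderIwaniecActa1986, §14 p. 245 ("`+ O(x^{ε−1})`")] -/
def errR (a : ℤ) (M Y : ℝ) (H₀ Xn Xq : ℕ) (r l : ℕ) : ℝ :=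
  ∑ q ∈ Icc 1 Xq, ∑ n ∈ Icc 1 Xn, ∑ h ∈ Icc 1 H₀,
    4 * π * |(a : ℝ)| * (M + 2 * Y) * h / ((((q * r : ℕ) : ℝ)) ^ 2 * ((l * n : ℕ) : ℝ))

/-- `errR ≥ 0` (for `M + 2Y ≥ 0`). [folklore] -/
theorem errR_nonneg (a : ℤ) {M Y : ℝ} (hMY : 0 ≤ M + 2 * Y) (H₀ Xn Xq r l : ℕ) :
    0 ≤ errR a M Y H₀ Xn Xq r l :=
  Finset.sum_nonneg fun _ _ => Finset.sum_nonneg fun _ _ => Finset.sum_nonneg fun _ _ => by positivity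

/-- **One term of reciprocity**: for `sg = ±1`, `(ln, qr) = 1`,
`‖(qr)⁻¹ twistPM sg (qr) (a(ln)‾) h − (qr)⁻¹ α̂(sg h/qr) e(sg h ρ'/(ln))‖ ≤ (M+2Y) 2π|a| h/((qr)² ln)`.
[cite: BombieriFriedlanderIwaniecActa1986, §14 p. 245] -/
theorem norm_twist_sub_recip_le {a : ℤ} {M Y : ℝ} (hY : 0 < Y) (hYM : Y ≤ M) {q r l n : ℕ}
    (hq : 0 < q) (hr : 0 < r) (hl : 0 < l) (hn : 0 < n) (hcop : (l * n).Coprime (q * r))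
    {sg : ℤ} (hsg : sg = 1 ∨ sg = -1) (h : ℕ) :
    ‖(((q * r : ℕ) : ℂ))⁻¹ * twistPM M Y sg (q * r) ((a : ZMod (q * r)) * (((l * n : ℕ) : ZMod (q * r)))⁻¹) h -
        ((((q * r : ℕ) : ℂ))⁻¹ * 𝓕 (bumpC M Y) ((sg : ℝ) * h / ((q * r : ℕ) : ℝ))) *
          ((𝐞 ((sg : ℝ) * (rhoR a q r l n : ℝ) * h / ((l * n : ℕ) : ℝ)) : Circle) : ℂ)‖ ≤
      (M + 2 * Y) * (2 * π * (|(a : ℝ)| * h / (((q * r : ℕ) : ℝ) * ((l * n : ℕ) : ℝ)))) / ((q * r : ℕ) : ℝ) := by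
  have hM : 0 ≤ M := hY.le.trans hYM
  have hk0 : (0 : ℝ) < ((q * r : ℕ) : ℝ) := by exact_mod_cast Nat.mul_pos hq hr
  set F : ℂ := 𝓕 (bumpC M Y) ((sg : ℝ) * h / ((q * r : ℕ) : ℝ)) with hF
  set e₁ : ℂ := ((𝐞 ((sg : ℝ) * ((((a : ZMod (q * r)) * (((l * n : ℕ) : ZMod (q * r)))⁻¹).val : ℕ) : ℝ) * h /
        ((q * r : ℕ) : ℝ)) : Circle) : ℂ) with he₁
  set e₂ : ℂ := ((𝐞 ((sg : ℝ) * (rhoR a q r l n : ℝ) * h / ((l * n : ℕ) : ℝ)) : Circle) : ℂ) with he₂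
  have htw : twistPM M Y sg (q * r) ((a : ZMod (q * r)) * (((l * n : ℕ) : ZMod (q * r)))⁻¹) h = e₁ * F := by
    simp only [twistPM, hF, he₁, Nat.cast_mul]
  have hid : (((q * r : ℕ) : ℂ))⁻¹ * (e₁ * F) - ((((q * r : ℕ) : ℂ))⁻¹ * F) * e₂ =
      (((q * r : ℕ) : ℂ))⁻¹ * (F * (e₁ - e₂)) := by ring
  rw [htw, hid, norm_mul, norm_inv, Complex.norm_natCast, norm_mul]
  have hF' : ‖F‖ ≤ M + 2 * Y := norm_fourier_bumpC_le hY hM _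
  have hE : ‖e₁ - e₂‖ ≤ 2 * π * (|(a : ℝ)| * h / (((q * r : ℕ) : ℝ) * ((l * n : ℕ) : ℝ))) :=
    norm_e_sub_e_reciprocity_int_le hq hr hl hn hcop a hsg h
  rw [div_eq_inv_mul]
  exact mul_le_mul_of_nonneg_left (mul_le_mul hF' hE (norm_nonneg _) (by positivity)) (by positivity)

/-- **Reciprocity for the oscillatory `q`-sum** ((14.2) → the form before separation, with BFI's
`O(x^{ε−1})`): `|oscQ(r,l) − Re(recipI(+1) + recipI(−1))| ≤ errR(r,l)` for `r, l ≥ 1`, `(r,a) = 1`,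
`(l,r) = 1`, `0 < Y ≤ M`, `|β|, |γ| ≤ 1`. [cite: BombieriFriedlanderIwaniecActa1986, §14 p. 245] -/
theorem abs_oscQ_sub_le {a : ℤ} {M Y : ℝ} (hY : 0 < Y) (hYM : Y ≤ M) (H₀ Xn Xq : ℕ) {β γ : ℕ → ℝ}
    (hβ : ∀ n, |β n| ≤ 1) (hγ : ∀ q, |γ q| ≤ 1) {r l : ℕ} (hr : 0 < r) (hl : 0 < l)
    (hra : IsCoprime (r : ℤ) a) (hlr : l.Coprime r) :
    |oscQ a M Y H₀ Xn Xq β γ r l - (recipI 1 a M Y H₀ Xn Xq β γ r l + recipI (-1) a M Y H₀ Xn Xq β γ r l).re| ≤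
      errR a M Y H₀ Xn Xq r l := by
  have hM : 0 ≤ M := hY.le.trans hYM
  set Fq : Finset ℕ := (Icc 1 Xq).filter (fun q : ℕ => IsCoprime (q : ℤ) (a * l)) with hFq
  -- the per-term quantities
  set T : ℕ → ℕ → ℕ → ℂ := fun q n h =>
    ((γ q * β n : ℝ) : ℂ) * ((((q * r : ℕ) : ℂ))⁻¹ *
      (twistPM M Y 1 (q * r) ((a : ZMod (q * r)) * (((l * n : ℕ) : ZMod (q * r)))⁻¹) h +
        twistPM M Y (-1) (q * r) ((a : ZMod (q * r)) * (((l * n : ℕ) : ZMod (q * r)))⁻¹) h)) with hT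
  set bd : ℕ → ℕ → ℕ → ℝ := fun q n h =>
    4 * π * |(a : ℝ)| * (M + 2 * Y) * h / ((((q * r : ℕ) : ℝ)) ^ 2 * ((l * n : ℕ) : ℝ)) with hbd
  -- `oscQ` as a real part
  have hosc : oscQ a M Y H₀ Xn Xq β γ r l =
      (∑ q ∈ Fq, ∑ n ∈ (Icc 1 Xn).filter (fun n => n.Coprime (q * r)), ∑ h ∈ Icc 1 H₀, T q n h).re := by
    unfold oscQ oscBr
    rw [Complex.re_sum]
    refine Finset.sum_congr rfl fun q _ => ?_
    rw [Complex.re_sum, Finset.mul_sum]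
    refine Finset.sum_congr rfl fun n _ => ?_
    rw [oscSum_eq_sum_twist, Finset.mul_sum, Complex.re_sum, Finset.mul_sum, Complex.re_sum, Finset.mul_sum]
    refine Finset.sum_congr rfl fun h _ => ?_
    simp only [hT]
    rw [Complex.ofReal_mul, mul_assoc, Complex.re_ofReal_mul, Complex.re_ofReal_mul, Nat.cast_mul]
  -- the recip sums
  have hrec : (recipI 1 a M Y H₀ Xn Xq β γ r l + recipI (-1) a M Y H₀ Xn Xq β γ r l) =
      ∑ q ∈ Fq, ∑ n ∈ (Icc 1 Xn).filter (fun n => n.Coprime (q * r)), ∑ h ∈ Icc 1 H₀,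
        (recipTerm 1 a M Y β γ q r l n h + recipTerm (-1) a M Y β γ q r l n h) := by
    unfold recipI
    rw [← Finset.sum_add_distrib]
    refine Finset.sum_congr rfl fun q _ => ?_
    rw [← Finset.sum_add_distrib]
    refine Finset.sum_congr rfl fun n _ => ?_
    rw [← Finset.sum_add_distrib]
  -- termwise bound on the filtered index set
  have hterm : ∀ q ∈ Fq, ∀ n ∈ (Icc 1 Xn).filter (fun n => n.Coprime (q * r)), ∀ h ∈ Icc 1 H₀,
      ‖T q n h - (recipTerm 1 a M Y β γ q r l n h + recipTerm (-1) a M Y β γ q r l n h)‖ ≤ bd q n h := by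
    intro q hq n hn h _
    have hq' := Finset.mem_filter.1 hq
    have hn' := Finset.mem_filter.1 hn
    have hq0 : 0 < q := (Finset.mem_Icc.1 hq'.1).1
    have hn0 : 0 < n := (Finset.mem_Icc.1 hn'.1).1
    obtain ⟨-, hlk⟩ := coprime_modulus hra hlr hq'.2
    have hcop : (l * n).Coprime (q * r) := Nat.Coprime.mul_left hlk hn'.2
    set c : ZMod (q * r) := (a : ZMod (q * r)) * (((l * n : ℕ) : ZMod (q * r)))⁻¹ with hc
    have hsplit : T q n h - (recipTerm 1 a M Y β γ q r l n h + recipTerm (-1) a M Y β γ q r l n h) =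
        ((γ q * β n : ℝ) : ℂ) *
          (((((q * r : ℕ) : ℂ))⁻¹ * twistPM M Y 1 (q * r) c h -
            ((((q * r : ℕ) : ℂ))⁻¹ * 𝓕 (bumpC M Y) (((1 : ℤ) : ℝ) * h / ((q * r : ℕ) : ℝ))) *
              ((𝐞 (((1 : ℤ) : ℝ) * (rhoR a q r l n : ℝ) * h / ((l * n : ℕ) : ℝ)) : Circle) : ℂ)) +
          ((((q * r : ℕ) : ℂ))⁻¹ * twistPM M Y (-1) (q * r) c h -
            ((((q * r : ℕ) : ℂ))⁻¹ * 𝓕 (bumpC M Y) (((-1 : ℤ) : ℝ) * h / ((q * r : ℕ) : ℝ))) *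
              ((𝐞 (((-1 : ℤ) : ℝ) * (rhoR a q r l n : ℝ) * h / ((l * n : ℕ) : ℝ)) : Circle) : ℂ))) := by
      simp only [hT, recipTerm]
      ring
    rw [hsplit, norm_mul, Complex.norm_real, Real.norm_eq_abs]
    have hγβ : |γ q * β n| ≤ 1 := abs_mul_le_one_of hγ hβ q n
    have h1 := norm_twist_sub_recip_le (a := a) hY hYM hq0 hr hl hn0 hcop (sg := 1) (Or.inl rfl) h
    have h2 := norm_twist_sub_recip_le (a := a) hY hYM hq0 hr hl hn0 hcop (sg := -1) (Or.inr rfl) h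
    have hk0 : (0 : ℝ) < ((q * r : ℕ) : ℝ) := by exact_mod_cast Nat.mul_pos hq0 hr
    have hln0 : (0 : ℝ) < ((l * n : ℕ) : ℝ) := by exact_mod_cast Nat.mul_pos hl hn0
    refine (mul_le_mul hγβ ((norm_add_le _ _).trans (add_le_add h1 h2)) (norm_nonneg _) zero_le_one).trans ?_
    rw [one_mul, hbd]
    refine le_of_eq ?_
    field_simp
    ring
  have hbd0 : ∀ q n h, 0 ≤ bd q n h := fun q n h => by simp only [hbd]; positivity
  rw [hosc, hrec, ← Complex.sub_re]
  refine (Complex.abs_re_le_norm _).trans ?_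
  rw [← Finset.sum_sub_distrib]
  refine (norm_sum_le _ _).trans ?_
  calc ∑ q ∈ Fq, ‖∑ n ∈ (Icc 1 Xn).filter (fun n => n.Coprime (q * r)), ∑ h ∈ Icc 1 H₀, T q n h -
          ∑ n ∈ (Icc 1 Xn).filter (fun n => n.Coprime (q * r)), ∑ h ∈ Icc 1 H₀,
            (recipTerm 1 a M Y β γ q r l n h + recipTerm (-1) a M Y β γ q r l n h)‖
      ≤ ∑ q ∈ Fq, ∑ n ∈ (Icc 1 Xn).filter (fun n => n.Coprime (q * r)), ∑ h ∈ Icc 1 H₀, bd q n h := by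
        refine Finset.sum_le_sum fun q hq => ?_
        rw [← Finset.sum_sub_distrib]
        refine (norm_sum_le _ _).trans (Finset.sum_le_sum fun n hn => ?_)
        rw [← Finset.sum_sub_distrib]
        exact (norm_sum_le _ _).trans (Finset.sum_le_sum fun h hh => hterm q hq n hn h hh)
    _ ≤ ∑ q ∈ Icc 1 Xq, ∑ n ∈ Icc 1 Xn, ∑ h ∈ Icc 1 H₀, bd q n h := by
        refine le_trans (Finset.sum_le_sum fun q _ => Finset.sum_le_sum_of_subset_of_nonneg
          (Finset.filter_subset _ _) fun n _ _ => Finset.sum_nonneg fun h _ => hbd0 q n h) ?_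
        exact Finset.sum_le_sum_of_subset_of_nonneg (Finset.filter_subset _ _) fun q _ _ =>
          Finset.sum_nonneg fun n _ => Finset.sum_nonneg fun h _ => hbd0 q n h
    _ = errR a M Y H₀ Xn Xq r l := by simp only [errR, hbd]

/-! ### Separation of variables: `(qr)⁻¹ α̂(w/qr) = r⁻¹ ∫ α(qξ) e(−ξw/r) dξ` -/

/-- **Separation of variables in `α̂`** (BFI p. 245: "`α̂(h/qr) = q ∫ α(ξq) e(ξh/r) dξ`", in the
form `(qr)⁻¹ α̂(w/(qr)) = r⁻¹ ∫ α(qξ) e(−ξw/r) dξ` for Mathlib's `𝓕`). [cite: BombieriFriedlanderIwaniecActa1986, §14 p. 245] -/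
theorem inv_mul_fourier_bumpC_eq (M Y : ℝ) {q r : ℕ} (hq : 0 < q) (hr : 0 < r) (w : ℝ) :
    (((q * r : ℕ) : ℂ))⁻¹ * 𝓕 (bumpC M Y) (w / ((q * r : ℕ) : ℝ)) =
      ((r : ℂ))⁻¹ * ∫ ξ : ℝ, ((𝐞 (-(ξ * w / r)) : Circle) : ℂ) * bumpC M Y (q * ξ) := by
  have hq0 : (0 : ℝ) < q := by exact_mod_cast hq
  have hr0 : (0 : ℝ) < r := by exact_mod_cast hr
  rw [Real.fourier_real_eq]
  set g : ℝ → ℂ := fun t => 𝐞 (-(t * (w / ((q * r : ℕ) : ℝ)))) • bumpC M Y t with hg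
  have h1 : ∫ ξ : ℝ, g ((q : ℝ) * ξ) = |((q : ℝ))⁻¹| • ∫ t, g t := Measure.integral_comp_mul_left g _
  rw [abs_of_pos (inv_pos.mpr hq0), ← Complex.coe_smul, Complex.ofReal_inv] at h1
  have h2 : ∫ t, g t = ((q : ℝ) : ℂ) * ∫ ξ : ℝ, g ((q : ℝ) * ξ) := by
    rw [h1, smul_eq_mul, ← mul_assoc, mul_inv_cancel₀ (by exact_mod_cast hq0.ne'), one_mul]
  rw [h2, ← mul_assoc]
  have h3 : (((q * r : ℕ) : ℂ))⁻¹ * ((q : ℝ) : ℂ) = ((r : ℂ))⁻¹ := by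
    have hqC : (q : ℂ) ≠ 0 := by exact_mod_cast hq0.ne'
    have hrC : (r : ℂ) ≠ 0 := by exact_mod_cast hr0.ne'
    push_cast
    field_simp
  rw [h3]
  congr 1
  refine integral_congr_ae (Filter.Eventually.of_forall fun ξ => ?_)
  simp only [hg, Circle.smul_def, smul_eq_mul]
  congr 3
  push_cast
  field_simp

/-- One term of the separated sum at `ξ`:
`γ(q) β(n) α(qξ) r⁻¹ · e(−ξ·sg·h/r) · e(sg·h ρ'/(ln))`. [cite: BombieriFriedlanderIwaniecActa1986, §14 p. 245] -/
def sepTerm (sg : ℤ) (a : ℤ) (M Y : ℝ) (β γ : ℕ → ℝ) (ξ : ℝ) (q r l n h : ℕ) : ℂ :=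
  ((γ q * β n * bump M Y (q * ξ) / r : ℝ) : ℂ) *
    ((𝐞 (-(ξ * ((sg : ℝ) * h) / r)) : Circle) : ℂ) *
      ((𝐞 ((sg : ℝ) * (rhoR a q r l n : ℝ) * h / ((l * n : ℕ) : ℝ)) : Circle) : ℂ)

/-- **The separated sum** at `(ξ; r, l)` for the sign `sg`:
`∑_{q,(q,al)=1} ∑_{n,(n,qr)=1} ∑_{h ≤ H₀} γ(q) β(n) α(qξ) r⁻¹ e(−sg ξh/r) e(sg h ρ'/(ln))` — the
integrand of BFI's display "`∫ |∑_r ∑_l ∑_h (δ_h/r) e(ξh/r) ∑_q ∑_n γ(q) α(ξq) β(n) e(…)| dξ`" at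
one `(r, l)`. [cite: BombieriFriedlanderIwaniecActa1986, §14 p. 245] -/
def sepSum (sg : ℤ) (a : ℤ) (M Y : ℝ) (H₀ Xn Xq : ℕ) (β γ : ℕ → ℝ) (ξ : ℝ) (r l : ℕ) : ℂ :=
  ∑ q ∈ (Icc 1 Xq).filter (fun q : ℕ => IsCoprime (q : ℤ) (a * l)),
    ∑ n ∈ (Icc 1 Xn).filter (fun n => n.Coprime (q * r)), ∑ h ∈ Icc 1 H₀, sepTerm sg a M Y β γ ξ q r l n h

/-- `sepTerm` is continuous in `ξ`. [folklore] -/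
theorem continuous_sepTerm (sg : ℤ) (a : ℤ) (M Y : ℝ) (β γ : ℕ → ℝ) (q r l n h : ℕ) :
    Continuous fun ξ : ℝ => sepTerm sg a M Y β γ ξ q r l n h := by
  unfold sepTerm
  refine Continuous.mul (Continuous.mul ?_ ?_) continuous_const
  · refine Complex.continuous_ofReal.comp ?_
    refine Continuous.div_const (Continuous.mul continuous_const ?_) _
    exact (contDiff_bump M Y).continuous.comp (continuous_const.mul continuous_id)
  · exact continuous_e_comp (by fun_prop)

/-- `sepTerm` vanishes unless `M − Y < qξ < 2M + Y` (`0 < Y ≤ M`). [folklore] -/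
theorem sepTerm_eq_zero_of {sg : ℤ} {a : ℤ} {M Y : ℝ} (hY : 0 < Y) (hYM : Y ≤ M) (β γ : ℕ → ℝ)
    {ξ : ℝ} {q : ℕ} (r l n h : ℕ) (hξ : (q : ℝ) * ξ ≤ M - Y ∨ 2 * M + Y ≤ (q : ℝ) * ξ) :
    sepTerm sg a M Y β γ ξ q r l n h = 0 := by
  have hM : 0 ≤ M := hY.le.trans hYM
  have hb : bump M Y ((q : ℝ) * ξ) = 0 := by
    rcases hξ with h1 | h2
    · exact bump_eq_zero_of_le hY hM h1
    · exact bump_eq_zero_of_ge hY hM h2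
  simp [sepTerm, hb]

/-- `sepTerm` has compact support in `ξ` (for `q ≥ 1`). [folklore] -/
theorem hasCompactSupport_sepTerm (sg : ℤ) (a : ℤ) {M Y : ℝ} (hY : 0 < Y) (hYM : Y ≤ M) (β γ : ℕ → ℝ)
    {q : ℕ} (hq : 0 < q) (r l n h : ℕ) :
    HasCompactSupport fun ξ : ℝ => sepTerm sg a M Y β γ ξ q r l n h := by
  have hq0 : (0 : ℝ) < q := by exact_mod_cast hq
  refine HasCompactSupport.intro (isCompact_Icc (a := (M - Y) / q) (b := (2 * M + Y) / q)) fun ξ hξ => ?_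
  rw [Set.mem_Icc, not_and_or, not_le, not_le] at hξ
  refine sepTerm_eq_zero_of hY hYM β γ r l n h ?_
  rcases hξ with h1 | h2
  · left
    rw [lt_div_iff₀ hq0] at h1
    linarith [mul_comm (q : ℝ) ξ]
  · right
    rw [div_lt_iff₀ hq0] at h2
    linarith [mul_comm (q : ℝ) ξ]

/-- `sepTerm` is integrable in `ξ`. [folklore] -/
theorem integrable_sepTerm (sg : ℤ) (a : ℤ) {M Y : ℝ} (hY : 0 < Y) (hYM : Y ≤ M) (β γ : ℕ → ℝ)
    {q : ℕ} (hq : 0 < q) (r l n h : ℕ) :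
    Integrable fun ξ : ℝ => sepTerm sg a M Y β γ ξ q r l n h :=
  (continuous_sepTerm sg a M Y β γ q r l n h).integrable_of_hasCompactSupport
    (hasCompactSupport_sepTerm sg a hY hYM β γ hq r l n h)

/-- **Separation of variables, one term**: `recipTerm = ∫ sepTerm dξ`. [cite: BombieriFriedlanderIwaniecActa1986, §14 p. 245] -/
theorem recipTerm_eq_integral (sg : ℤ) (a : ℤ) (M Y : ℝ) (β γ : ℕ → ℝ) {q r : ℕ} (hq : 0 < q)
    (hr : 0 < r) (l n h : ℕ) :
    recipTerm sg a M Y β γ q r l n h = ∫ ξ : ℝ, sepTerm sg a M Y β γ ξ q r l n h := by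
  have hF : (((q * r : ℕ) : ℂ))⁻¹ * 𝓕 (bumpC M Y) ((sg : ℝ) * h / ((q * r : ℕ) : ℝ)) =
      ((r : ℂ))⁻¹ * ∫ ξ : ℝ, ((𝐞 (-(ξ * ((sg : ℝ) * h) / r)) : Circle) : ℂ) * bumpC M Y (q * ξ) :=
    inv_mul_fourier_bumpC_eq M Y hq hr ((sg : ℝ) * h)
  have hI : ∫ ξ : ℝ, (((γ q * β n : ℝ) : ℂ) * ((r : ℂ))⁻¹) *
        (((𝐞 (-(ξ * ((sg : ℝ) * h) / r)) : Circle) : ℂ) * bumpC M Y (q * ξ)) *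
          ((𝐞 ((sg : ℝ) * (rhoR a q r l n : ℝ) * h / ((l * n : ℕ) : ℝ)) : Circle) : ℂ) =
      (((γ q * β n : ℝ) : ℂ) * ((r : ℂ))⁻¹) *
        (∫ ξ : ℝ, ((𝐞 (-(ξ * ((sg : ℝ) * h) / r)) : Circle) : ℂ) * bumpC M Y (q * ξ)) *
          ((𝐞 ((sg : ℝ) * (rhoR a q r l n : ℝ) * h / ((l * n : ℕ) : ℝ)) : Circle) : ℂ) := by
    rw [integral_mul_const, integral_const_mul]
  unfold recipTerm
  rw [hF, show ((γ q * β n : ℝ) : ℂ) *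
      (((r : ℂ))⁻¹ * ∫ ξ : ℝ, ((𝐞 (-(ξ * ((sg : ℝ) * h) / r)) : Circle) : ℂ) * bumpC M Y (q * ξ)) *
        ((𝐞 ((sg : ℝ) * (rhoR a q r l n : ℝ) * h / ((l * n : ℕ) : ℝ)) : Circle) : ℂ) =
      (((γ q * β n : ℝ) : ℂ) * ((r : ℂ))⁻¹) *
        (∫ ξ : ℝ, ((𝐞 (-(ξ * ((sg : ℝ) * h) / r)) : Circle) : ℂ) * bumpC M Y (q * ξ)) *
          ((𝐞 ((sg : ℝ) * (rhoR a q r l n : ℝ) * h / ((l * n : ℕ) : ℝ)) : Circle) : ℂ) by ring, ← hI]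
  refine integral_congr_ae (Filter.Eventually.of_forall fun ξ => ?_)
  simp only [sepTerm, bumpC_apply]
  push_cast
  ring

/-- **Separation of variables for the `q, n, h`-sum**: `recipI(r, l) = ∫ sepSum(ξ; r, l) dξ`.
[cite: BombieriFriedlanderIwaniecActa1986, §14 p. 245] -/
theorem recipI_eq_integral_sepSum (sg : ℤ) (a : ℤ) {M Y : ℝ} (hY : 0 < Y) (hYM : Y ≤ M)
    (H₀ Xn Xq : ℕ) (β γ : ℕ → ℝ) {r : ℕ} (hr : 0 < r) (l : ℕ) :
    recipI sg a M Y H₀ Xn Xq β γ r l = ∫ ξ : ℝ, sepSum sg a M Y H₀ Xn Xq β γ ξ r l := by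
  unfold recipI sepSum
  rw [integral_finsetSum]
  · refine Finset.sum_congr rfl fun q hq => ?_
    have hq0 : 0 < q := (Finset.mem_Icc.1 (Finset.mem_filter.1 hq).1).1
    rw [integral_finsetSum]
    · refine Finset.sum_congr rfl fun n _ => ?_
      rw [integral_finsetSum]
      · exact Finset.sum_congr rfl fun h _ => recipTerm_eq_integral sg a M Y β γ hq0 hr l n h
      · intro h _
        exact integrable_sepTerm sg a hY hYM β γ hq0 r l n h
    · intro n _
      exact integrable_finsetSum _ fun h _ => integrable_sepTerm sg a hY hYM β γ hq0 r l n h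
  · intro q hq
    have hq0 : 0 < q := (Finset.mem_Icc.1 (Finset.mem_filter.1 hq).1).1
    exact integrable_finsetSum _ fun n _ => integrable_finsetSum _ fun h _ =>
      integrable_sepTerm sg a hY hYM β γ hq0 r l n h

/-- `sepSum` is continuous in `ξ`. [folklore] -/
theorem continuous_sepSum (sg : ℤ) (a : ℤ) (M Y : ℝ) (H₀ Xn Xq : ℕ) (β γ : ℕ → ℝ) (r l : ℕ) :
    Continuous fun ξ : ℝ => sepSum sg a M Y H₀ Xn Xq β γ ξ r l := by
  unfold sepSum
  refine continuous_finsetSum _ fun q _ => continuous_finsetSum _ fun n _ =>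
    continuous_finsetSum _ fun h _ => continuous_sepTerm sg a M Y β γ q r l n h

/-- `sepSum` is integrable in `ξ`. [folklore] -/
theorem integrable_sepSum (sg : ℤ) (a : ℤ) {M Y : ℝ} (hY : 0 < Y) (hYM : Y ≤ M) (H₀ Xn Xq : ℕ)
    (β γ : ℕ → ℝ) (r l : ℕ) :
    Integrable fun ξ : ℝ => sepSum sg a M Y H₀ Xn Xq β γ ξ r l := by
  unfold sepSum
  refine integrable_finsetSum _ fun q hq => integrable_finsetSum _ fun n _ =>
    integrable_finsetSum _ fun h _ => ?_
  have hq0 : 0 < q := (Finset.mem_Icc.1 (Finset.mem_filter.1 hq).1).1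
  exact integrable_sepTerm sg a hY hYM β γ hq0 r l n h

/-- **Support in `ξ`**: if `γ` lives on `q ≥ Q₀ > 0`, then `sepSum(ξ) = 0` unless
`0 < ξ < (2M + Y)/Q₀`. [folklore] -/
theorem sepSum_eq_zero_of {sg : ℤ} {a : ℤ} {M Y : ℝ} (hY : 0 < Y) (hYM : Y ≤ M) (H₀ Xn Xq : ℕ)
    {β γ : ℕ → ℝ} {Q₀ : ℝ} (hQ₀ : 0 < Q₀) (hγQ : ∀ q, γ q ≠ 0 → Q₀ ≤ (q : ℝ)) {ξ : ℝ}
    (hξ : ξ ≤ 0 ∨ (2 * M + Y) / Q₀ ≤ ξ) (r l : ℕ) :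
    sepSum sg a M Y H₀ Xn Xq β γ ξ r l = 0 := by
  have hM : 0 ≤ M := hY.le.trans hYM
  unfold sepSum
  refine Finset.sum_eq_zero fun q hq => Finset.sum_eq_zero fun n _ => Finset.sum_eq_zero fun h _ => ?_
  by_cases hγ : γ q = 0
  · simp [sepTerm, hγ]
  · have hqQ : Q₀ ≤ (q : ℝ) := hγQ q hγ
    have hq0 : (0 : ℝ) < q := hQ₀.trans_le hqQ
    refine sepTerm_eq_zero_of hY hYM β γ r l n h ?_
    rcases hξ with h1 | h2
    · left
      have : (q : ℝ) * ξ ≤ 0 := mul_nonpos_of_nonneg_of_nonpos hq0.le h1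
      linarith
    · right
      have hξ0 : 0 ≤ ξ := le_trans (by positivity) h2
      calc 2 * M + Y = (2 * M + Y) / Q₀ * Q₀ := by field_simp
        _ ≤ ξ * (q : ℝ) := mul_le_mul h2 hqQ hQ₀.le hξ0
        _ = (q : ℝ) * ξ := mul_comm _ _

/-- **From the separated sums to `tripleOsc`** (the display of BFI p. 245 with the integral over
`ξ` estimated by the length of its range times the supremum): if `γ` lives on `q ≥ Q₀ > 0`,
`0 < Y ≤ M`, `|β|, |γ| ≤ 1`, and for both signs `sg = ±1` and every `ξ ∈ (0, ξ₁)`,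
`ξ₁ = (2M + Y)/Q₀`, `∑_{r∼R,(r,a)=1} ∑_{l∼L,(l,r)=1} ‖sepSum sg (ξ; r, l)‖ ≤ Φ`, then
`tripleOsc ≤ 2 ξ₁ Φ + ∑_{r∼R} ∑_{l∼L} errR(r, l)`.
[cite: BombieriFriedlanderIwaniecActa1986, §14 p. 245] -/
theorem tripleOsc_le_of_sepSum_le {a : ℤ} {M Y : ℝ} (hY : 0 < Y) (hYM : Y ≤ M) (H₀ Xn Xq : ℕ)
    {β γ : ℕ → ℝ} (hβ : ∀ n, |β n| ≤ 1) (hγ : ∀ q, |γ q| ≤ 1) {Q₀ : ℝ} (hQ₀ : 0 < Q₀)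
    (hγQ : ∀ q, γ q ≠ 0 → Q₀ ≤ (q : ℝ)) {L R : ℝ} (hL : 0 ≤ L) (hR : 0 ≤ R) {Φ : ℝ}
    (hΦ : ∀ sg : ℤ, (sg = 1 ∨ sg = -1) → ∀ ξ : ℝ, 0 < ξ → ξ < (2 * M + Y) / Q₀ →
      ∑ r ∈ (dyadic R).filter (fun r : ℕ => IsCoprime (r : ℤ) a),
        ∑ l ∈ (dyadic L).filter (fun l : ℕ => l.Coprime r), ‖sepSum sg a M Y H₀ Xn Xq β γ ξ r l‖ ≤ Φ) :
    tripleOsc a M Y H₀ Xn Xq β γ L R ≤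
      2 * ((2 * M + Y) / Q₀ * Φ) + ∑ r ∈ dyadic R, ∑ l ∈ dyadic L, errR a M Y H₀ Xn Xq r l := by
  have hM : 0 ≤ M := hY.le.trans hYM
  set ξ₁ : ℝ := (2 * M + Y) / Q₀ with hξ₁
  have hξ₁0 : 0 < ξ₁ := by positivity
  set FR : Finset ℕ := (dyadic R).filter (fun r : ℕ => IsCoprime (r : ℤ) a) with hFR
  -- the integral bound for each sign
  have hint : ∀ sg : ℤ, (sg = 1 ∨ sg = -1) →
      ∑ r ∈ FR, ∑ l ∈ (dyadic L).filter (fun l : ℕ => l.Coprime r),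
        ‖recipI sg a M Y H₀ Xn Xq β γ r l‖ ≤ ξ₁ * Φ := by
    intro sg hsg
    -- `‖recipI‖ ≤ ∫ ‖sepSum‖`
    have h1 : ∀ r ∈ FR, ∀ l ∈ (dyadic L).filter (fun l : ℕ => l.Coprime r),
        ‖recipI sg a M Y H₀ Xn Xq β γ r l‖ ≤ ∫ ξ : ℝ, ‖sepSum sg a M Y H₀ Xn Xq β γ ξ r l‖ := by
      intro r hr l _
      have hr0 : 0 < r := pos_of_mem_dyadic hR (Finset.mem_filter.1 hr).1
      rw [recipI_eq_integral_sepSum sg a hY hYM H₀ Xn Xq β γ hr0 l]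
      exact norm_integral_le_integral_norm _
    -- sum of integrals = integral of the sum
    set S : ℝ → ℝ := fun ξ => ∑ r ∈ FR, ∑ l ∈ (dyadic L).filter (fun l : ℕ => l.Coprime r),
      ‖sepSum sg a M Y H₀ Xn Xq β γ ξ r l‖ with hS
    have hSint : ∫ ξ : ℝ, S ξ = ∑ r ∈ FR, ∑ l ∈ (dyadic L).filter (fun l : ℕ => l.Coprime r),
        ∫ ξ : ℝ, ‖sepSum sg a M Y H₀ Xn Xq β γ ξ r l‖ := by
      simp only [hS]
      rw [integral_finsetSum]
      · refine Finset.sum_congr rfl fun r _ => ?_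
        rw [integral_finsetSum]
        intro l _
        exact (integrable_sepSum sg a hY hYM H₀ Xn Xq β γ r l).norm
      · intro r _
        exact integrable_finsetSum _ fun l _ => (integrable_sepSum sg a hY hYM H₀ Xn Xq β γ r l).norm
    -- `S` vanishes off `(0, ξ₁)` and is `≤ Φ` on it
    have hSzero : ∀ ξ, ξ ∉ Set.Ioo 0 ξ₁ → S ξ = 0 := by
      intro ξ hξ
      rw [Set.mem_Ioo, not_and_or, not_lt, not_lt] at hξ
      simp only [hS]
      refine Finset.sum_eq_zero fun r _ => Finset.sum_eq_zero fun l _ => ?_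
      rw [sepSum_eq_zero_of hY hYM H₀ Xn Xq hQ₀ hγQ hξ r l, norm_zero]
    have hSle : ∀ ξ ∈ Set.Ioo 0 ξ₁, ‖S ξ‖ ≤ Φ := by
      intro ξ hξ
      rw [Real.norm_eq_abs, abs_of_nonneg (Finset.sum_nonneg fun r _ => Finset.sum_nonneg fun l _ => norm_nonneg _)]
      exact hΦ sg hsg ξ hξ.1 hξ.2
    have hSbound : ∫ ξ : ℝ, S ξ ≤ ξ₁ * Φ := by
      rw [← setIntegral_eq_integral_of_forall_compl_eq_zero (s := Set.Ioo 0 ξ₁) (fun ξ hξ => hSzero ξ hξ)]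
      have hvol : volume (Set.Ioo (0 : ℝ) ξ₁) < ⊤ := by rw [Real.volume_Ioo]; exact ENNReal.ofReal_lt_top
      have h := norm_setIntegral_le_of_norm_le_const hvol hSle
      rw [Measure.real, Real.volume_Ioo, ENNReal.toReal_ofReal (by linarith), sub_zero] at h
      calc ∫ ξ in Set.Ioo 0 ξ₁, S ξ ≤ ‖∫ ξ in Set.Ioo 0 ξ₁, S ξ‖ := Real.le_norm_self _
        _ ≤ Φ * ξ₁ := h
        _ = ξ₁ * Φ := mul_comm _ _
    calc ∑ r ∈ FR, ∑ l ∈ (dyadic L).filter (fun l : ℕ => l.Coprime r), ‖recipI sg a M Y H₀ Xn Xq β γ r l‖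
        ≤ ∑ r ∈ FR, ∑ l ∈ (dyadic L).filter (fun l : ℕ => l.Coprime r),
            ∫ ξ : ℝ, ‖sepSum sg a M Y H₀ Xn Xq β γ ξ r l‖ :=
          Finset.sum_le_sum fun r hr => Finset.sum_le_sum fun l hl => h1 r hr l hl
      _ = ∫ ξ : ℝ, S ξ := hSint.symm
      _ ≤ ξ₁ * Φ := hSbound
  -- assemble
  unfold tripleOsc
  calc ∑ r ∈ FR, ∑ l ∈ (dyadic L).filter (fun l : ℕ => l.Coprime r), |oscQ a M Y H₀ Xn Xq β γ r l|
      ≤ ∑ r ∈ FR, ∑ l ∈ (dyadic L).filter (fun l : ℕ => l.Coprime r),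
          (‖recipI 1 a M Y H₀ Xn Xq β γ r l‖ + ‖recipI (-1) a M Y H₀ Xn Xq β γ r l‖ +
            errR a M Y H₀ Xn Xq r l) := by
        refine Finset.sum_le_sum fun r hr => Finset.sum_le_sum fun l hl => ?_
        have hr' := Finset.mem_filter.1 hr
        have hl' := Finset.mem_filter.1 hl
        have hr0 : 0 < r := pos_of_mem_dyadic hR hr'.1
        have hl0 : 0 < l := pos_of_mem_dyadic hL hl'.1
        have hd := abs_oscQ_sub_le hY hYM H₀ Xn Xq hβ hγ hr0 hl0 hr'.2 hl'.2 (a := a)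
        have hre : |(recipI 1 a M Y H₀ Xn Xq β γ r l + recipI (-1) a M Y H₀ Xn Xq β γ r l).re| ≤
            ‖recipI 1 a M Y H₀ Xn Xq β γ r l‖ + ‖recipI (-1) a M Y H₀ Xn Xq β γ r l‖ :=
          (Complex.abs_re_le_norm _).trans (norm_add_le _ _)
        have := abs_sub_abs_le_abs_sub (oscQ a M Y H₀ Xn Xq β γ r l)
          ((recipI 1 a M Y H₀ Xn Xq β γ r l + recipI (-1) a M Y H₀ Xn Xq β γ r l).re)
        linarith
    _ = (∑ r ∈ FR, ∑ l ∈ (dyadic L).filter (fun l : ℕ => l.Coprime r), ‖recipI 1 a M Y H₀ Xn Xq β γ r l‖) +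
          (∑ r ∈ FR, ∑ l ∈ (dyadic L).filter (fun l : ℕ => l.Coprime r), ‖recipI (-1) a M Y H₀ Xn Xq β γ r l‖) +
          ∑ r ∈ FR, ∑ l ∈ (dyadic L).filter (fun l : ℕ => l.Coprime r), errR a M Y H₀ Xn Xq r l := by
        simp only [Finset.sum_add_distrib]
    _ ≤ ξ₁ * Φ + ξ₁ * Φ + ∑ r ∈ dyadic R, ∑ l ∈ dyadic L, errR a M Y H₀ Xn Xq r l := by
        have hMY : 0 ≤ M + 2 * Y := by positivity
        refine add_le_add (add_le_add (hint 1 (Or.inl rfl)) (hint (-1) (Or.inr rfl))) ?_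
        calc ∑ r ∈ FR, ∑ l ∈ (dyadic L).filter (fun l : ℕ => l.Coprime r), errR a M Y H₀ Xn Xq r l
            ≤ ∑ r ∈ FR, ∑ l ∈ dyadic L, errR a M Y H₀ Xn Xq r l :=
              Finset.sum_le_sum fun r _ => Finset.sum_le_sum_of_subset_of_nonneg (Finset.filter_subset _ _)
                fun l _ _ => errR_nonneg a hMY H₀ Xn Xq r l
          _ ≤ ∑ r ∈ dyadic R, ∑ l ∈ dyadic L, errR a M Y H₀ Xn Xq r l :=
              Finset.sum_le_sum_of_subset_of_nonneg (Finset.filter_subset _ _) fun r _ _ =>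
                Finset.sum_nonneg fun l _ => errR_nonneg a hMY H₀ Xn Xq r l
    _ = 2 * (ξ₁ * Φ) + ∑ r ∈ dyadic R, ∑ l ∈ dyadic L, errR a M Y H₀ Xn Xq r l := by ring

/-! ### The size of the reciprocity error -/

/-- `∑_{k ≤ n} 1/k ≤ 1 + log n` (Mathlib's `harmonic_le_one_add_log`). [folklore] -/
theorem sum_Icc_inv_le_one_add_log (n : ℕ) : ∑ k ∈ Icc 1 n, (1 : ℝ) / k ≤ 1 + Real.log n := by
  have h := harmonic_le_one_add_log n
  rw [harmonic_eq_sum_Icc, Rat.cast_sum] at h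
  refine le_trans (le_of_eq ?_) h
  refine Finset.sum_congr rfl fun k _ => ?_
  push_cast
  rw [one_div]

/-- `∑_{h ≤ H₀} h ≤ H₀²`. [folklore] -/
theorem sum_Icc_natCast_le_sq (H₀ : ℕ) : ∑ h ∈ Icc 1 H₀, (h : ℝ) ≤ (H₀ : ℝ) ^ 2 := by
  calc ∑ h ∈ Icc 1 H₀, (h : ℝ) ≤ ∑ _h ∈ Icc 1 H₀, (H₀ : ℝ) :=
        Finset.sum_le_sum fun h hh => by exact_mod_cast (Finset.mem_Icc.1 hh).2
    _ = (H₀ : ℝ) ^ 2 := by simp [sq]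

/-- `∑_{r ∼ R} 1/r² ≤ 2/R` for `R > 0`. [folklore] -/
theorem sum_dyadic_one_div_sq_le {R : ℝ} (hR : 0 < R) : ∑ r ∈ dyadic R, (1 : ℝ) / (r : ℝ) ^ 2 ≤ 2 / R := by
  calc ∑ r ∈ dyadic R, (1 : ℝ) / (r : ℝ) ^ 2 ≤ ∑ r ∈ dyadic R, (1 / R) * (1 / (r : ℝ)) := by
        refine Finset.sum_le_sum fun r hr => ?_
        have h1 := ((mem_dyadic hR.le).1 hr).1
        have hr0 : (0 : ℝ) < r := hR.trans h1
        rw [sq, one_div_mul_one_div, one_div_le_one_div (by positivity) (by positivity)]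
        exact mul_le_mul_of_nonneg_right h1.le hr0.le
    _ = (1 / R) * ∑ r ∈ dyadic R, (1 / (r : ℝ)) := by rw [Finset.mul_sum]
    _ ≤ (1 / R) * 2 := mul_le_mul_of_nonneg_left (sum_dyadic_one_div_le_two hR.le) (by positivity)
    _ = 2 / R := by ring

/-- **The total reciprocity error** (BFI's `O(x^{ε−1})` summed trivially):
`∑_{r∼R} ∑_{l∼L} errR(r, l) ≤ 32π |a| (M + 2Y) H₀² (1 + log Xn)/R`. With `H₀ ≍ x^{2ε₁}QR/M` this is
`≪ |a| x^{4ε₁} Q²R ℒ/M ≤ |a| x^{1+4ε₁} ℒ/M` under (14.4), admissible once `M > x^{5ε₁}`.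
[cite: BombieriFriedlanderIwaniecActa1986, §14 p. 245] -/
theorem sum_errR_le (a : ℤ) {M Y : ℝ} (hMY : 0 ≤ M + 2 * Y) (H₀ Xn Xq : ℕ) {L R : ℝ} (hL : 0 ≤ L)
    (hR : 0 < R) :
    ∑ r ∈ dyadic R, ∑ l ∈ dyadic L, errR a M Y H₀ Xn Xq r l ≤
      32 * π * |(a : ℝ)| * (M + 2 * Y) * (H₀ : ℝ) ^ 2 * (1 + Real.log Xn) / R := by
  set A : ℝ := 4 * π * |(a : ℝ)| * (M + 2 * Y) with hA
  have hA0 : 0 ≤ A := by positivity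
  set P : ℝ := ∑ q ∈ Icc 1 Xq, ∑ n ∈ Icc 1 Xn, ∑ h ∈ Icc 1 H₀, (1 / (q : ℝ) ^ 2) * ((1 / (n : ℝ)) * (h : ℝ))
    with hP
  have hPeq : P = (∑ q ∈ Icc 1 Xq, 1 / (q : ℝ) ^ 2) * ((∑ n ∈ Icc 1 Xn, 1 / (n : ℝ)) * ∑ h ∈ Icc 1 H₀, (h : ℝ)) := by
    rw [hP, Finset.sum_mul]
    refine Finset.sum_congr rfl fun q _ => ?_
    rw [Finset.sum_mul (s := Icc 1 Xn), Finset.mul_sum (s := Icc 1 Xn)]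
    refine Finset.sum_congr rfl fun n _ => ?_
    rw [Finset.mul_sum (s := Icc 1 H₀), Finset.mul_sum (s := Icc 1 H₀)]
  have hlog0 : 0 ≤ 1 + Real.log Xn := by
    rcases Nat.eq_zero_or_pos Xn with h | h
    · simp [h]
    · linarith [Real.log_nonneg (show (1 : ℝ) ≤ Xn by exact_mod_cast h)]
  have h10 : 0 ≤ ∑ q ∈ Icc 1 Xq, 1 / (q : ℝ) ^ 2 := Finset.sum_nonneg fun q _ => by positivity
  have h40 : 0 ≤ ∑ n ∈ Icc 1 Xn, 1 / (n : ℝ) := Finset.sum_nonneg fun n _ => by positivity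
  have h50 : 0 ≤ ∑ h ∈ Icc 1 H₀, (h : ℝ) := Finset.sum_nonneg fun h _ => by positivity
  have hPle : P ≤ 2 * ((1 + Real.log Xn) * (H₀ : ℝ) ^ 2) := by
    rw [hPeq]
    exact mul_le_mul (sum_Icc_one_div_sq_le_two Xq) (mul_le_mul (sum_Icc_inv_le_one_add_log Xn)
      (sum_Icc_natCast_le_sq H₀) h50 hlog0) (by positivity) (by norm_num)
  -- one `(r, l)` term
  have herr : ∀ r ∈ dyadic R, ∀ l ∈ dyadic L,
      errR a M Y H₀ Xn Xq r l = A * (1 / (r : ℝ) ^ 2) * (1 / (l : ℝ)) * P := by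
    intro r hr l hl
    have hr0 : (0 : ℝ) < r := by exact_mod_cast pos_of_mem_dyadic hR.le hr
    have hl0 : (0 : ℝ) < l := by exact_mod_cast pos_of_mem_dyadic hL hl
    unfold errR
    rw [hP, Finset.mul_sum]
    refine Finset.sum_congr rfl fun q hq => ?_
    rw [Finset.mul_sum]
    refine Finset.sum_congr rfl fun n hn => ?_
    rw [Finset.mul_sum]
    refine Finset.sum_congr rfl fun h _ => ?_
    have hq0 : (0 : ℝ) < q := by exact_mod_cast (Finset.mem_Icc.1 hq).1
    have hn0 : (0 : ℝ) < n := by exact_mod_cast (Finset.mem_Icc.1 hn).1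
    rw [hA]
    push_cast
    field_simp
  calc ∑ r ∈ dyadic R, ∑ l ∈ dyadic L, errR a M Y H₀ Xn Xq r l
      = ∑ r ∈ dyadic R, ∑ l ∈ dyadic L, A * (1 / (r : ℝ) ^ 2) * (1 / (l : ℝ)) * P :=
        Finset.sum_congr rfl fun r hr => Finset.sum_congr rfl fun l hl => herr r hr l hl
    _ = A * P * ((∑ r ∈ dyadic R, 1 / (r : ℝ) ^ 2) * ∑ l ∈ dyadic L, 1 / (l : ℝ)) := by
        rw [Finset.sum_mul_sum, Finset.mul_sum]
        refine Finset.sum_congr rfl fun r _ => ?_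
        rw [Finset.mul_sum]
        refine Finset.sum_congr rfl fun l _ => ?_
        ring
    _ ≤ A * (2 * ((1 + Real.log Xn) * (H₀ : ℝ) ^ 2)) * ((2 / R) * 2) := by
        have h20 : 0 ≤ ∑ r ∈ dyadic R, 1 / (r : ℝ) ^ 2 := Finset.sum_nonneg fun r _ => by positivity
        have h30 : 0 ≤ ∑ l ∈ dyadic L, 1 / (l : ℝ) := Finset.sum_nonneg fun l _ => by positivity
        refine mul_le_mul (mul_le_mul_of_nonneg_left hPle hA0) (mul_le_mul (sum_dyadic_one_div_sq_le hR)
          (sum_dyadic_one_div_le_two hL) h30 (by positivity)) (by positivity) (by positivity)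
    _ = 32 * π * |(a : ℝ)| * (M + 2 * Y) * (H₀ : ℝ) ^ 2 * (1 + Real.log Xn) / R := by
        rw [hA]; field_simp; ring

/-! ### The same over sets `SL ⊆ (l ∼ L)`, `SR ⊆ (r ∼ R)` -/

/-- **From the separated sums to `tripleOscS`** (as `tripleOsc_le_of_sepSum_le`, over sets
`SL ⊆ (l ∼ L)`, `SR ⊆ (r ∼ R)`; the reciprocity errors are summed over the full dyadic ranges).
[cite: BombieriFriedlanderIwaniecActa1986, §14 p. 245] -/
theorem tripleOscS_le_of_sepSum_le {a : ℤ} {M Y : ℝ} (hY : 0 < Y) (hYM : Y ≤ M) (H₀ Xn Xq : ℕ)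
    {β γ : ℕ → ℝ} (hβ : ∀ n, |β n| ≤ 1) (hγ : ∀ q, |γ q| ≤ 1) {Q₀ : ℝ} (hQ₀ : 0 < Q₀)
    (hγQ : ∀ q, γ q ≠ 0 → Q₀ ≤ (q : ℝ)) {L R : ℝ} (hL : 0 ≤ L) (hR : 0 ≤ R) {SL SR : Finset ℕ}
    (hSL : SL ⊆ dyadic L) (hSR : SR ⊆ dyadic R) {Φ : ℝ}
    (hΦ : ∀ sg : ℤ, (sg = 1 ∨ sg = -1) → ∀ ξ : ℝ, 0 < ξ → ξ < (2 * M + Y) / Q₀ →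
      ∑ r ∈ SR.filter (fun r : ℕ => IsCoprime (r : ℤ) a),
        ∑ l ∈ SL.filter (fun l : ℕ => l.Coprime r), ‖sepSum sg a M Y H₀ Xn Xq β γ ξ r l‖ ≤ Φ) :
    tripleOscS a M Y H₀ Xn Xq β γ SL SR ≤
      2 * ((2 * M + Y) / Q₀ * Φ) + ∑ r ∈ dyadic R, ∑ l ∈ dyadic L, errR a M Y H₀ Xn Xq r l := by
  have hM : 0 ≤ M := hY.le.trans hYM
  set ξ₁ : ℝ := (2 * M + Y) / Q₀ with hξ₁
  have hξ₁0 : 0 < ξ₁ := by positivity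
  set FR : Finset ℕ := SR.filter (fun r : ℕ => IsCoprime (r : ℤ) a) with hFR
  -- the integral bound for each sign
  have hint : ∀ sg : ℤ, (sg = 1 ∨ sg = -1) →
      ∑ r ∈ FR, ∑ l ∈ SL.filter (fun l : ℕ => l.Coprime r),
        ‖recipI sg a M Y H₀ Xn Xq β γ r l‖ ≤ ξ₁ * Φ := by
    intro sg hsg
    -- `‖recipI‖ ≤ ∫ ‖sepSum‖`
    have h1 : ∀ r ∈ FR, ∀ l ∈ SL.filter (fun l : ℕ => l.Coprime r),
        ‖recipI sg a M Y H₀ Xn Xq β γ r l‖ ≤ ∫ ξ : ℝ, ‖sepSum sg a M Y H₀ Xn Xq β γ ξ r l‖ := by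
      intro r hr l _
      have hr0 : 0 < r := pos_of_mem_dyadic hR (hSR (Finset.mem_filter.1 hr).1)
      rw [recipI_eq_integral_sepSum sg a hY hYM H₀ Xn Xq β γ hr0 l]
      exact norm_integral_le_integral_norm _
    -- sum of integrals = integral of the sum
    set S : ℝ → ℝ := fun ξ => ∑ r ∈ FR, ∑ l ∈ SL.filter (fun l : ℕ => l.Coprime r),
      ‖sepSum sg a M Y H₀ Xn Xq β γ ξ r l‖ with hS
    have hSint : ∫ ξ : ℝ, S ξ = ∑ r ∈ FR, ∑ l ∈ SL.filter (fun l : ℕ => l.Coprime r),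
        ∫ ξ : ℝ, ‖sepSum sg a M Y H₀ Xn Xq β γ ξ r l‖ := by
      simp only [hS]
      rw [integral_finsetSum]
      · refine Finset.sum_congr rfl fun r _ => ?_
        rw [integral_finsetSum]
        intro l _
        exact (integrable_sepSum sg a hY hYM H₀ Xn Xq β γ r l).norm
      · intro r _
        exact integrable_finsetSum _ fun l _ => (integrable_sepSum sg a hY hYM H₀ Xn Xq β γ r l).norm
    -- `S` vanishes off `(0, ξ₁)` and is `≤ Φ` on it
    have hSzero : ∀ ξ, ξ ∉ Set.Ioo 0 ξ₁ → S ξ = 0 := by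
      intro ξ hξ
      rw [Set.mem_Ioo, not_and_or, not_lt, not_lt] at hξ
      simp only [hS]
      refine Finset.sum_eq_zero fun r _ => Finset.sum_eq_zero fun l _ => ?_
      rw [sepSum_eq_zero_of hY hYM H₀ Xn Xq hQ₀ hγQ hξ r l, norm_zero]
    have hSle : ∀ ξ ∈ Set.Ioo 0 ξ₁, ‖S ξ‖ ≤ Φ := by
      intro ξ hξ
      rw [Real.norm_eq_abs, abs_of_nonneg (Finset.sum_nonneg fun r _ => Finset.sum_nonneg fun l _ => norm_nonneg _)]
      exact hΦ sg hsg ξ hξ.1 hξ.2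
    have hSbound : ∫ ξ : ℝ, S ξ ≤ ξ₁ * Φ := by
      rw [← setIntegral_eq_integral_of_forall_compl_eq_zero (s := Set.Ioo 0 ξ₁) (fun ξ hξ => hSzero ξ hξ)]
      have hvol : volume (Set.Ioo (0 : ℝ) ξ₁) < ⊤ := by rw [Real.volume_Ioo]; exact ENNReal.ofReal_lt_top
      have h := norm_setIntegral_le_of_norm_le_const hvol hSle
      rw [Measure.real, Real.volume_Ioo, ENNReal.toReal_ofReal (by linarith), sub_zero] at h
      calc ∫ ξ in Set.Ioo 0 ξ₁, S ξ ≤ ‖∫ ξ in Set.Ioo 0 ξ₁, S ξ‖ := Real.le_norm_self _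
        _ ≤ Φ * ξ₁ := h
        _ = ξ₁ * Φ := mul_comm _ _
    calc ∑ r ∈ FR, ∑ l ∈ SL.filter (fun l : ℕ => l.Coprime r), ‖recipI sg a M Y H₀ Xn Xq β γ r l‖
        ≤ ∑ r ∈ FR, ∑ l ∈ SL.filter (fun l : ℕ => l.Coprime r),
            ∫ ξ : ℝ, ‖sepSum sg a M Y H₀ Xn Xq β γ ξ r l‖ :=
          Finset.sum_le_sum fun r hr => Finset.sum_le_sum fun l hl => h1 r hr l hl
      _ = ∫ ξ : ℝ, S ξ := hSint.symm
      _ ≤ ξ₁ * Φ := hSbound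
  -- assemble
  unfold tripleOscS
  calc ∑ r ∈ FR, ∑ l ∈ SL.filter (fun l : ℕ => l.Coprime r), |oscQ a M Y H₀ Xn Xq β γ r l|
      ≤ ∑ r ∈ FR, ∑ l ∈ SL.filter (fun l : ℕ => l.Coprime r),
          (‖recipI 1 a M Y H₀ Xn Xq β γ r l‖ + ‖recipI (-1) a M Y H₀ Xn Xq β γ r l‖ +
            errR a M Y H₀ Xn Xq r l) := by
        refine Finset.sum_le_sum fun r hr => Finset.sum_le_sum fun l hl => ?_
        have hr' := Finset.mem_filter.1 hr
        have hl' := Finset.mem_filter.1 hl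
        have hr0 : 0 < r := pos_of_mem_dyadic hR (hSR hr'.1)
        have hl0 : 0 < l := pos_of_mem_dyadic hL (hSL hl'.1)
        have hd := abs_oscQ_sub_le hY hYM H₀ Xn Xq hβ hγ hr0 hl0 hr'.2 hl'.2 (a := a)
        have hre : |(recipI 1 a M Y H₀ Xn Xq β γ r l + recipI (-1) a M Y H₀ Xn Xq β γ r l).re| ≤
            ‖recipI 1 a M Y H₀ Xn Xq β γ r l‖ + ‖recipI (-1) a M Y H₀ Xn Xq β γ r l‖ :=
          (Complex.abs_re_le_norm _).trans (norm_add_le _ _)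
        have := abs_sub_abs_le_abs_sub (oscQ a M Y H₀ Xn Xq β γ r l)
          ((recipI 1 a M Y H₀ Xn Xq β γ r l + recipI (-1) a M Y H₀ Xn Xq β γ r l).re)
        linarith
    _ = (∑ r ∈ FR, ∑ l ∈ SL.filter (fun l : ℕ => l.Coprime r), ‖recipI 1 a M Y H₀ Xn Xq β γ r l‖) +
          (∑ r ∈ FR, ∑ l ∈ SL.filter (fun l : ℕ => l.Coprime r), ‖recipI (-1) a M Y H₀ Xn Xq β γ r l‖) +
          ∑ r ∈ FR, ∑ l ∈ SL.filter (fun l : ℕ => l.Coprime r), errR a M Y H₀ Xn Xq r l := by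
        simp only [Finset.sum_add_distrib]
    _ ≤ ξ₁ * Φ + ξ₁ * Φ + ∑ r ∈ dyadic R, ∑ l ∈ dyadic L, errR a M Y H₀ Xn Xq r l := by
        have hMY : 0 ≤ M + 2 * Y := by positivity
        refine add_le_add (add_le_add (hint 1 (Or.inl rfl)) (hint (-1) (Or.inr rfl))) ?_
        calc ∑ r ∈ FR, ∑ l ∈ SL.filter (fun l : ℕ => l.Coprime r), errR a M Y H₀ Xn Xq r l
            ≤ ∑ r ∈ FR, ∑ l ∈ dyadic L, errR a M Y H₀ Xn Xq r l :=
              Finset.sum_le_sum fun r _ => Finset.sum_le_sum_of_subset_of_nonneg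
                ((Finset.filter_subset _ _).trans hSL) fun l _ _ => errR_nonneg a hMY H₀ Xn Xq r l
          _ ≤ ∑ r ∈ dyadic R, ∑ l ∈ dyadic L, errR a M Y H₀ Xn Xq r l :=
              Finset.sum_le_sum_of_subset_of_nonneg ((Finset.filter_subset _ _).trans hSR) fun r _ _ =>
                Finset.sum_nonneg fun l _ => errR_nonneg a hMY H₀ Xn Xq r l
    _ = 2 * (ξ₁ * Φ) + ∑ r ∈ dyadic R, ∑ l ∈ dyadic L, errR a M Y H₀ Xn Xq r l := by ring


end BFI

end Literature.NumberTheory.Sieve
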